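import Mathlib
import HarnessLib
import Literature.Computability.Complexity.ConstantDepth
import Literature.Computability.Complexity.FourierTails
import Literature.Computability.Complexity.RandomKSatLowDegreeHardness
import Summits.PneNP.PneNP.Theorems.OverlapGapAlgebraSearchHardWindowRungAssembly
import Summits.PneNP.PneNP.Theorems.OverlapGapAlgebraSearchHardWindowTruncationSurrogate
import Summits.PneNP.PneNP.Theorems.OverlapGapAlgebraSearchHardWindowVanishingLowDegree

/-!
# Route OverlapGapAlgebra, crux `SearchHardWindow` (stmt-PneNP-2460): the CLASS RUNG with vanishing
# success, unconditionally

Line A's class rung `shw_classRung` (`…RungAssembly.lean`, lead prover-line-stmt-PneNP-2460-0) turns a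
low-degree hardness statement for random `k`-SAT into: every family of Boolean functions (one per
output variable, reading the instance bits under `litArrayOfBits`) drawn from classes whose Fourier
tails above a level `D n` are eventually `≤ n⁻³` solves `F_k(2^j, ⌊α_k 2^j⌋)` on at most an
`ε`-fraction of inputs, every `ε > 0`. There it is CONDITIONAL on the named fact
`HuangSellke2025KSat` (levels `D n = o(n)`). This file runs the same proof on the UNCONDITIONAL
theorem `vanishingLowDegreeHardness` (`…VanishingLowDegree.lean`, this seat: the conclusion of the
named fact for degrees `o(n/log² n)`), with the truncation surrogate `stub_truncationSurrogate`
plugged in: **`vanishingClassRung` — the class rung for every tail level `D n = o(n/log² n)`, with no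
named fact and no hypothesis.** Polylogarithmic levels (`AC⁰`, Tal's tails) and query budgets
`o(n/log² n)` (decision trees) are covered; the corresponding rungs are in `…VanishingRungs.lean`.
The proof is that of `shw_classRung` verbatim (adapted; its transport lemmas `shwRung_*` are
imported), except that the hardness input is a theorem.

References: B. Huang, M. Sellke, arXiv:2501.06427, Cor. 3.21 [HuangSellke2025]; A. Tal, CCC 2017,
Thm. 3.6 [Tal2017]; R. O'Donnell, *Analysis of Boolean Functions*, §3, §8 [ODonnell2014].
-/

-- `Summit.PneNP.PneNP.…` is the tree's mandated namespace (summit = sub-problem name).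
set_option linter.dupNamespace false

noncomputable section

namespace Summit.PneNP.PneNP.Theorems

open Finset Filter Asymptotics
open Literature.Computability.Complexity
open Literature.Computability.Complexity.LowDegree
open Literature.Probability.RandomGraphs.LowDegree (sgn walsh)
open scoped Classical

-- adapted from Summits/PneNP/PneNP/Theorems/OverlapGapAlgebraSearchHardWindowRungAssembly.lean (shw_classRung)
/-- **Class rung with vanishing success, unconditional.** Let `𝒢 n N` be, for each `n`, a class of
Boolean functions on `N` input bits whose Fourier tails above a level `D n = o(n/log² n)` (`D n ≥ 1`)
are eventually `≤ n⁻³`. Then for `k ≥ k₀` and every `ε > 0`, eventually in `n`, whenever `n = 2^j`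
and `m = ⌊5 · 2^k log k / k · n⌋`, every family `g : Fin (2^j) → 𝒢 n (m k (j+1))` (one Boolean
function per output variable, reading the instance bits) outputs a satisfying assignment of the
decoded literal array for at most `ε · 2^{m k (j+1)}` inputs. (`shw_classRung` run on
`vanishingLowDegreeHardness` and `stub_truncationSurrogate`.) [HuangSellke2025, Cor. 3.21] -/
theorem vanishingClassRung :
    ∃ k₀ : ℕ, ∀ k : ℕ, k₀ ≤ k → ∀ (𝒢 : (n N : ℕ) → ((Fin N → Bool) → Bool) → Prop) (D : ℕ → ℕ),
      (fun n : ℕ => (D n : ℝ)) =o[atTop] (fun n : ℕ => (n : ℝ) / Real.log n ^ 2) → (∀ n, 1 ≤ D n) →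
      (∀ᶠ n : ℕ in atTop, ∀ (N : ℕ) (g : (Fin N → Bool) → Bool), 𝒢 n N g →
        tailWeight (fun x => sgn (g x)) (D n) ≤ 1 / (n : ℝ) ^ 3) →
      ∀ ε : ℝ, 0 < ε →
      ∀ᶠ n : ℕ in atTop, ∀ j m : ℕ, n = 2 ^ j → m = ⌊5 * 2 ^ k * Real.log k / k * n⌋₊ →
        ∀ g : Fin (2 ^ j) → (Fin (m * k * (j + 1)) → Bool) → Bool,
          (∀ v, 𝒢 n (m * k * (j + 1)) (g v)) →
          ((univ.filter fun x : Fin (m * k * (j + 1)) → Bool =>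
              ∀ i : Fin m, ∃ j' : Fin k, g (litArrayOfBits m k j x i j').1 x =
                (litArrayOfBits m k j x i j').2).card : ℝ)
            ≤ ε * 2 ^ (m * k * (j + 1)) := by
  obtain ⟨k₀, hLDH⟩ := vanishingLowDegreeHardness
  refine ⟨k₀, fun k hk 𝒢 D hDo hD1 hTail ε hε => ?_⟩
  -- numbers of clauses and of instance bits at level `j` (`n = 2^j`, `m = M j = ⌊α_k 2^j⌋`)
  let M : ℕ → ℕ := fun j => ⌊5 * 2 ^ k * Real.log k / k * ((2 ^ j : ℕ) : ℝ)⌋₊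
  let N : ℕ → ℕ := fun j => M j * k * (j + 1)
  let OK : (j : ℕ) → (Fin (2 ^ j) → (Fin (N j) → Bool) → Bool) → Prop := fun j g =>
    ∀ v, 𝒢 (2 ^ j) (N j) (g v)
  let cnt : (j : ℕ) → (Fin (2 ^ j) → (Fin (N j) → Bool) → Bool) → ℕ := fun j g =>
    (univ.filter fun x : Fin (N j) → Bool => ∀ i, ∃ j',
      g (litArrayOfBits (M j) k j x i j').1 x =
        (litArrayOfBits (M j) k j x i j').2).card
  let bad : ℕ → Prop := fun j => ∃ g, OK j g ∧ ε * 2 ^ (N j) < (cnt j g : ℝ)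
  -- a bad family wherever one exists
  obtain ⟨gb, hgb⟩ : ∃ gb : (j : ℕ) → Fin (2 ^ j) → (Fin (N j) → Bool) → Bool,
      ∀ j, bad j → OK j (gb j) ∧ ε * 2 ^ (N j) < (cnt j (gb j) : ℝ) := by
    refine ⟨fun j => if h : bad j then h.choose else fun _ _ => false, fun j hj => ?_⟩
    simp only [dif_pos hj]
    exact hj.choose_spec
  -- tail levels (equal to `n⁻³` as soon as the tail bound is available)
  let τ : ℕ → ℝ := fun j =>
    if ∀ v, tailWeight (fun x => sgn (gb j v x)) (D (2 ^ j)) ≤ 1 / ((2 ^ j : ℕ) : ℝ) ^ 3 then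
      1 / ((2 ^ j : ℕ) : ℝ) ^ 3
    else ∑ v, tailWeight (fun x => sgn (gb j v x)) (D (2 ^ j))
  have hτ : ∀ j v, tailWeight (fun x => sgn (gb j v x)) (D (2 ^ j)) ≤ τ j := by
    intro j v
    simp only [τ]
    split_ifs with h
    · exact h v
    · exact Finset.single_le_sum
        (f := fun w => tailWeight (fun x => sgn (gb j w x)) (D (2 ^ j)))
        (fun w _ => tailWeight_nonneg _ _) (mem_univ v)
  -- surrogate coefficients from the truncation stub
  choose coef hcoef0 hcoefE hcoefB using
    fun j => stub_truncationSurrogate (D (2 ^ j)) (hD1 _) (fun v x => gb j v x) (τ j) (hτ j)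
  -- the low-degree functions: on the cube, on literal arrays at level `j`, and for all `(n, m)`
  let P : (j : ℕ) → (Fin (N j) → Bool) → Fin (2 ^ j) → ℝ := fun j x v => ∑ S, coef j v S * walsh S x
  let G : (j : ℕ) → (Fin (M j) → Fin k → Fin (2 ^ j) × Bool) → Fin (2 ^ j) → ℝ :=
    fun j Ψ v => P j (bitsOfLitArray (M j) k j Ψ) v
  let F : (n m : ℕ) → (Fin m → Fin k → Fin n × Bool) → Fin n → ℝ := fun n m Φ v =>
    if h : 2 ^ Nat.log 2 n = n ∧ m = M (Nat.log 2 n) then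
      G (Nat.log 2 n) (fun a b => (((Φ (a.cast h.2.symm) b).1).cast h.1.symm,
        (Φ (a.cast h.2.symm) b).2)) (v.cast h.1.symm)
    else 0
  -- (i) coordinate degree
  have hGdeg : ∀ (j : ℕ) (v : Fin (2 ^ j)), IsCoordDegreeLE (D (2 ^ j))
      (fun y : Fin (M j) × Fin k → Fin (2 ^ j) × Bool => G j (Function.curry y) v) :=
    fun j v =>
      shwRung_isCoordDegreeLE_walshSum (M j) k j (D (2 ^ j)) (coef j v) (hcoef0 j v)
  have hdeg : ∀ (n m : ℕ) (v : Fin n), IsCoordDegreeLE (D n)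
      (fun y : Fin m × Fin k → Fin n × Bool => F n m (Function.curry y) v) := by
    intro n m v
    by_cases h : 2 ^ Nat.log 2 n = n ∧ m = M (Nat.log 2 n)
    · have hfun : (fun y : Fin m × Fin k → Fin n × Bool => F n m (Function.curry y) v) =
          fun y =>
            G (Nat.log 2 n) (fun a b => (((Function.curry y (a.cast h.2.symm) b).1).cast h.1.symm,
              (Function.curry y (a.cast h.2.symm) b).2)) (v.cast h.1.symm) := by
        funext y; simp only [F, dif_pos h]
      rw [hfun]
      have hD : D n = D (2 ^ Nat.log 2 n) := by rw [h.1]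
      rw [hD]
      exact shwRung_isCoordDegreeLE_cast h.2 h.1.symm
        (fun Ψ => G (Nat.log 2 n) Ψ (v.cast h.1.symm)) (hGdeg (Nat.log 2 n) (v.cast h.1.symm))
    · have hfun : (fun y : Fin m × Fin k → Fin n × Bool => F n m (Function.curry y) v) =
          fun _ => 0 := by
        funext y; simp only [F, dif_neg h]
      rw [hfun]; exact IsCoordDegreeLE.zero _
  -- (ii) energy
  have hener : ∀ n m : ℕ, m = ⌊5 * 2 ^ k * Real.log k / k * n⌋₊ →
      ∑ Φ : Fin m → Fin k → Fin n × Bool, ∑ v : Fin n, F n m Φ v ^ 2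
        ≤ 9 * n * Fintype.card (Fin m → Fin k → Fin n × Bool) := by
    intro n m _
    by_cases h : 2 ^ Nat.log 2 n = n ∧ m = M (Nat.log 2 n)
    · have hsum : ∑ Φ : Fin m → Fin k → Fin n × Bool, ∑ v : Fin n, F n m Φ v ^ 2 =
          ∑ Φ : Fin m → Fin k → Fin n × Bool, ∑ v : Fin n,
            (fun Ψ w => G (Nat.log 2 n) Ψ w ^ 2) (fun a b =>
              (((Φ (a.cast h.2.symm) b).1).cast h.1.symm, (Φ (a.cast h.2.symm) b).2))
              (v.cast h.1.symm) := by
        simp only [F, dif_pos h]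
      rw [hsum, shwRung_sum_cast h.2 h.1.symm (fun Ψ w => G (Nat.log 2 n) Ψ w ^ 2),
        shwRung_card_cast k h.2 h.1.symm, card_litArray_two_pow]
      have hG : ∑ Ψ : Fin (M (Nat.log 2 n)) → Fin k → Fin (2 ^ Nat.log 2 n) × Bool, ∑ w,
          G (Nat.log 2 n) Ψ w ^ 2 =
            ∑ x : Fin (N (Nat.log 2 n)) → Bool, ∑ w, P (Nat.log 2 n) x w ^ 2 := by
        refine Fintype.sum_equiv
          (litArrayEquiv (M (Nat.log 2 n)) k (Nat.log 2 n)).symm _ _ fun Ψ => ?_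
        rfl
      rw [hG]
      have hE := hcoefE (Nat.log 2 n)
      have hn : (n : ℝ) = ((2 ^ Nat.log 2 n : ℕ) : ℝ) := by rw [h.1]
      rw [hn]
      push_cast at hE ⊢
      exact hE
    · have h0 : ∑ Φ : Fin m → Fin k → Fin n × Bool, ∑ v : Fin n, F n m Φ v ^ 2 = 0 := by
        simp only [F, dif_neg h]; simp
      rw [h0]; positivity
  -- (iii) the low-degree theorem, the tail bound and the small error term, eventually
  have hev := hLDH k hk 9 (by norm_num) D hDo F hdeg hener (ε / 2) (half_pos hε)
  have hsmall : ∀ᶠ n : ℕ in atTop, (9 : ℝ) * n * (1 / (n : ℝ) ^ 3) ≤ ε / 2 := by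
    filter_upwards [eventually_ge_atTop (⌈18 / ε⌉₊ + 1)] with n hn
    have hn1 : (1 : ℝ) ≤ n := by exact_mod_cast le_trans (Nat.le_add_left 1 _) hn
    have hnε : 18 / ε ≤ n := (Nat.le_ceil _).trans (by exact_mod_cast le_trans (Nat.le_succ _) hn)
    have hnpos : (0 : ℝ) < n := by linarith
    have h18 : 18 ≤ ε * n := by rwa [div_le_iff₀ hε, mul_comm] at hnε
    have h18' : 18 ≤ ε * n ^ 2 := h18.trans (by nlinarith)
    rw [mul_one_div, div_le_iff₀ (by positivity)]
    nlinarith [h18', hnpos]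
  filter_upwards [hev, hTail, hsmall] with n hn1 hn2 hn3
  intro j m hnj hm g hOK
  subst hnj
  subst hm
  -- from now on `n = 2^j`, `m = M j`
  by_contra hlt
  rw [not_le] at hlt
  have hbad : bad j := by simp only [bad]; exact ⟨g, hOK, hlt⟩
  obtain ⟨hOKb, hcntb⟩ := hgb j hbad
  -- the tail bound is available for the chosen bad family, so `τ j = n⁻³`
  have hτj : τ j = 1 / ((2 ^ j : ℕ) : ℝ) ^ 3 := by
    simp only [τ]
    rw [if_pos]
    intro v
    exact hn2 _ _ (hOKb v)
  -- good inputs: the surrogate is saturated and has the family's signs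
  let good : (Fin (N j) → Bool) → Prop := fun x =>
    ∀ v, 1 ≤ |P j x v| ∧ decide (0 ≤ P j x v) = gb j v x
  have hbadset : ((univ.filter fun x : Fin (N j) → Bool => ¬ good x).card : ℝ) ≤
      ε / 2 * 2 ^ (N j) := by
    refine (hcoefB j).trans ?_
    rw [hτj]
    exact mul_le_mul_of_nonneg_right hn3 (by positivity : (0 : ℝ) ≤ 2 ^ (N j))
  -- good solved inputs inject into the event bounded by the low-degree theorem
  have hgoodset : ((univ.filter fun x : Fin (N j) → Bool => (∀ i, ∃ j',
      gb j (litArrayOfBits (M j) k j x i j').1 x =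
        (litArrayOfBits (M j) k j x i j').2) ∧ good x).card : ℝ) ≤ ε / 2 * 2 ^ (N j) := by
    have key : ∀ (Φ : Fin (M j) → Fin k → Fin (2 ^ j) × Bool) (v : Fin (2 ^ j)),
        F (2 ^ j) (M j) Φ v = G j Φ v := by
      intro Φ v
      have h1 : 2 ^ Nat.log 2 (2 ^ j) = 2 ^ j := by rw [Nat.log_pow Nat.one_lt_ofNat]
      have h2 : M j = M (Nat.log 2 (2 ^ j)) := by
        rw [Nat.log_pow Nat.one_lt_ofNat]
      have h12 : 2 ^ Nat.log 2 (2 ^ j) = 2 ^ j ∧ M j = M (Nat.log 2 (2 ^ j)) :=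
        ⟨h1, h2⟩
      have hF : F (2 ^ j) (M j) Φ v =
          G (Nat.log 2 (2 ^ j)) (fun a b => (((Φ (a.cast h2.symm) b).1).cast h1.symm,
            (Φ (a.cast h2.symm) b).2)) (v.cast h1.symm) := by
        simp only [F, dif_pos h12]
      rw [hF]
      exact shwRung_cast_transport M G (Nat.log_pow Nat.one_lt_ofNat j) h2 h1.symm Φ v
    have hfact := hn1 (M j) rfl
    rw [card_litArray_two_pow] at hfact
    push_cast at hfact
    refine le_trans ?_ hfact
    refine Nat.cast_le.2 (Finset.card_le_card_of_injOn (litArrayOfBits (M j) k j)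
      (fun x hx => ?_) (fun x _ y _ hxy => litArrayOfBits_injective hxy))
    simp only [coe_filter, mem_univ, true_and, Set.mem_setOf_eq] at hx ⊢
    obtain ⟨hsol, hgood⟩ := hx
    refine ⟨fun v => ?_, fun i => ?_⟩
    · rw [key]
      simpa [G, bitsOfLitArray_litArrayOfBits] using (hgood v).1
    · obtain ⟨j', hj'⟩ := hsol i
      refine ⟨j', ?_⟩
      rw [key, ← hj']
      simpa [G, bitsOfLitArray_litArrayOfBits] using (hgood _).2
  -- conclusion: the bad family is not bad after all
  have hnat := shwRung_card_filter_le_and_add_not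
    (fun x : Fin (N j) → Bool => ∀ i, ∃ j',
      gb j (litArrayOfBits (M j) k j x i j').1 x =
        (litArrayOfBits (M j) k j x i j').2) good
  have hcnt : (cnt j (gb j) : ℝ) ≤ ε / 2 * 2 ^ (N j) + ε / 2 * 2 ^ (N j) := by
    have h' := (Nat.cast_le (α := ℝ)).2 hnat
    push_cast at h'
    exact h'.trans (add_le_add hgoodset hbadset)
  linarith

end Summit.PneNP.PneNP.Theorems

end
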